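import Literature.LinearAlgebra.MatrixPolynomials.CameronPsarrakos2019.Witness
import HarnessLib

/-!
# Cameron–Psarrakos (2019): the rule `z₊(P) ≤ n·α(P)` AS PRINTED (all sizes, degrees, sign patterns) is false,
# over `ℝ` and over `ℂ`

Source: T. R. Cameron and P. J. Psarrakos, *On Descartes' rule of signs for matrix polynomials*, Operators and
Matrices **13** (2019) 643–652, doi:10.7153/oam-2019-13-48 [CameronPsarrakos2019]: p. 644 (the class `S` of
self-adjoint `n × n` matrix polynomials `P(λ) = Σ λⁱ Aᵢ` whose coefficients are each positive definite, negative
definite or null; `α(P)` = number of sign alternations of the definite coefficient sequence, null coefficients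
ignored; `z₊(P)` = number of positive real eigenvalues = positive real roots of `det P`), display (6)
`z₊(P) ≤ n · α(P)`, and p. 646: "We conjecture that (6), in fact, holds for all matrix polynomials in S."  Proved
there for `α ∈ {0, 1, m}` (Lemma 6), hyperbolic `P` (Thm 3), congruence-diagonalizable `P` (Prop. 4) and degree
`≤ 3` (Thm 7).  CATEGORY: an explicitly stated conjecture, REFUTED by an explicit integer witness at `n = 2`,
`α(P) = 2`: `P(t) = C₀ + t⁶C₆ + t⁷C₇ + t⁸C₈ + t¹⁵C₁₅` with `C₀, C₆, C₈, C₁₅ ≻ 0`, `C₇ ≺ 0` integer symmetric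
(`Cₐ = 10⁶·Σ_{deg vₖ = a} vₖvₖᵀ + I`, `C₇ = −(10⁶·wwᵀ + I)`, `v = ((16,−74),(−74,282),(−17,−19),(−83,81),(−48,13))`
at degrees `(0,6,8,8,15)`, `w = (0,200)`), whose determinant takes the signs `+ − + − + − +` at
`t = 1/8, 1/4, 1/2, 1, 2, 4, 8` (exact rational arithmetic), so by the intermediate value theorem `det P` has at
least SIX distinct positive real roots: `z₊(P) ≥ 6 > 4 = n·α(P)`.

This module writes the statement in the generality of the paper (p. 644 class `S`, `α(P)`, `z₊(P)`; p. 646 "for all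
matrix polynomials in S") and derives its negation from the instance of `Literature.LinearAlgebra.MatrixPolynomials.CameronPsarrakos2019.Witness`:
* a matrix polynomial of size `n` and degree (bound) `m` is a coefficient sequence `A : Fin (m+1) → Matrix (Fin n)
  (Fin n) 𝕜`, `P(λ) = Σᵢ λ^i Aᵢ` (`matPoly A`), over `𝕜 = ℝ` or `ℂ` (`RCLike`);
* `P ∈ S` iff every coefficient is positive definite, negative definite or null (`InS A`; Mathlib's `Matrix.PosDef`
  includes `IsHermitian`, so `P` is self-adjoint); the paper assumes `P` regular (`det P ≢ 0`), kept as a hypothesis;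
* `α(P)` = number of sign alternations of the coefficient signs IGNORING null coefficients (`alpha A`, p. 644);
* `z₊(P)` = number of positive real eigenvalues, i.e. real positive roots of `det P`, counted WITH multiplicity
  (`zplus A`);
* display (6): `z₊(P) ≤ n·α(P)` — `CameronPsarrakosRule 𝕜` (a cited definition — tombstone — refuted here; no
  `_holds` can exist).
Headline: **`cameronPsarrakosRule_real_false : ¬ CameronPsarrakosRule ℝ`** and **`cameronPsarrakosRule_complex_false :
¬ CameronPsarrakosRule ℂ`** (the paper's coefficients are complex Hermitian; the real symmetric witness embeds).

Provenance: refutations bundle `papers/_cross/refutations` (H21 seat pub-refute-2, 2026-08-18), package modules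
`Refutations.CameronPsarrakos` and `Refutations.CameronPsarrakosGeneral`, moved into the tree under the Lean-in-tree
rule (human 2026-08-18).  DUPLICATION NOTE for the operator: the witness module was itself VENDORED FROM THIS TREE —
`Summits/ValiantsHypothesis/ValiantsHypothesis/Theorems/LacunarySymmetroidMatrixDescartesDefiniteWitness.lean` (decl
`…LacunarySymmetroidMatrixDescartes.cameronPsarrakos_counterexample`, found by a Valiant-side route), with the two
folklore lemmas it imports (`le_card_posRoots_of_alternating` from `…/SymmetroidDescartesRolleToDescartes.lean`,
`eval_det_pencil` from `…/LacunarySymmetroidMatrixDescartesStubReverse.lean`) inlined; a Literature file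
cannot have `Summits.*` imports, so this is a re-homing of a refutation of a PUBLISHED statement to where such
reproductions live, and the Summits files could be re-pointed at it.  Renamed from the bundle: `CameronPsarrakosConjecture ↦
CameronPsarrakosRule`, `cameronPsarrakosConjecture_real_false ↦ cameronPsarrakosRule_real_false`,
`cameronPsarrakosConjecture_complex_false ↦ cameronPsarrakosRule_complex_false`.
-/

open Polynomial
open scoped ComplexOrder

namespace Literature.LinearAlgebra.MatrixPolynomials.CameronPsarrakos2019

/-! ### The rule in print generality -/

section General

variable {𝕜 : Type*} [RCLike 𝕜]

/-- number of sign alternations of a list of signs `∈ {1, 0, −1}`, IGNORING zeros [folklore] -/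
def alternations (l : List ℤ) : ℕ :=
  let l' := l.filter (fun s => s ≠ 0)
  (l'.zip l'.tail).countP (fun p => p.1 * p.2 < 0)

/-- sign of a definite-or-null Hermitian matrix: `0` if null, `1` if positive definite, `−1` otherwise
(i.e. negative definite, under the class-`S` hypothesis) [folklore] -/
noncomputable def coeffSign {n : ℕ} (A : Matrix (Fin n) (Fin n) 𝕜) : ℤ := by
  classical exact if A = 0 then 0 else if A.PosDef then 1 else -1

/-- `α(P)`: alternations of signs of the coefficient sequence, null coefficients ignored [cite: CameronPsarrakos2019, p. 644] -/
noncomputable def alpha {n m : ℕ} (A : Fin (m + 1) → Matrix (Fin n) (Fin n) 𝕜) : ℕ :=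
  alternations (List.ofFn fun i => coeffSign (A i))

/-- the matrix polynomial `P(X) = Σᵢ X^i • Aᵢ` with polynomial entries [cite: CameronPsarrakos2019, p. 644] -/
noncomputable def matPoly {n m : ℕ} (A : Fin (m + 1) → Matrix (Fin n) (Fin n) 𝕜) :
    Matrix (Fin n) (Fin n) 𝕜[X] :=
  ∑ i : Fin (m + 1), ((X : 𝕜[X]) ^ (i : ℕ)) • (A i).map Polynomial.C

/-- `z₊(P)`: the number of positive real eigenvalues of `P` (real positive roots of `det P`),
counted with multiplicity [cite: CameronPsarrakos2019, p. 644] -/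
noncomputable def zplus {n m : ℕ} (A : Fin (m + 1) → Matrix (Fin n) (Fin n) 𝕜) : ℕ :=
  Multiset.card ((matPoly A).det.roots.filter (fun μ => RCLike.im μ = 0 ∧ 0 < RCLike.re μ))

/-- `P ∈ S`: every coefficient is positive definite, negative definite, or null [cite: CameronPsarrakos2019, p. 644] -/
def InS {n m : ℕ} (A : Fin (m + 1) → Matrix (Fin n) (Fin n) 𝕜) : Prop :=
  ∀ i, (A i).PosDef ∨ (-(A i)).PosDef ∨ A i = 0

variable (𝕜) in
/-- The Cameron–Psarrakos matrix Descartes rule in print generality (display (6), asserted on p. 646 "for all matrix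
polynomials in `S`"): for every size `n`, degree `m` and every regular `P ∈ S` over `𝕜`, `z₊(P) ≤ n · α(P)`.
**REFUTED in this file** over `ℝ` and over `ℂ` (`cameronPsarrakosRule_real_false`, `cameronPsarrakosRule_complex_false`). [cite: CameronPsarrakos2019, display (6) p. 644, p. 646] -/
def CameronPsarrakosRule : Prop :=
  ∀ (n m : ℕ) (A : Fin (m + 1) → Matrix (Fin n) (Fin n) 𝕜),
    InS A → (matPoly A).det ≠ 0 → zplus A ≤ n * alpha A

end General

/-! ### The real instance of module `Witness` as a coefficient sequence of degree 15 -/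

/-- coefficient sequence of the witness: `A₀ = C₀, A₆ = C₆, A₇ = C₇, A₈ = C₈, A₁₅ = C₁₅`, all other `Aᵢ = 0` [folklore] -/
noncomputable def Aw : Fin 16 → Matrix (Fin 2) (Fin 2) ℝ := fun i =>
  if (i : ℕ) = 0 then Cpos 0 else if (i : ℕ) = 6 then Cpos 1 else if (i : ℕ) = 7 then J
  else if (i : ℕ) = 8 then Cpos 2 else if (i : ℕ) = 15 then Cpos 3 else 0

/-- Auxiliary lemma: `: matPoly Aw = P`. [folklore] -/
theorem matPoly_Aw : matPoly Aw = P := by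
  unfold matPoly P Aw
  simp [Fin.sum_univ_succ, dpos, e]
  abel

/-- a matrix cannot be both positive and negative definite (size `≥ 1`) [folklore] -/
theorem not_posDef_of_neg_posDef {n : ℕ} [NeZero n] {𝕜 : Type*} [RCLike 𝕜]
    {A : Matrix (Fin n) (Fin n) 𝕜} (h : (-A).PosDef) : ¬ A.PosDef := by
  intro h'
  have hx : (fun _ : Fin n => (1 : 𝕜)) ≠ 0 := by
    intro h0; have := congrFun h0 0; simp at this
  have h1 := h'.dotProduct_mulVec_pos hx
  have h2 := h.dotProduct_mulVec_pos hx
  rw [Matrix.neg_mulVec, dotProduct_neg] at h2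
  have := add_pos h1 h2
  simp at this

/-- Auxiliary lemma: `(k : Fin 4) : Cpos k ≠ 0`. [folklore] -/
theorem Cpos_ne_zero (k : Fin 4) : Cpos k ≠ 0 := by
  intro h
  have := congrFun (congrFun h 0) 0
  fin_cases k <;> simp [Cpos, V, Matrix.vecMulVec] at this <;> norm_num at this

/-- Auxiliary lemma: `: J ≠ 0`. [folklore] -/
theorem J_ne_zero : J ≠ 0 := by
  intro h
  have := congrFun (congrFun h 0) 0
  simp [J, w, Matrix.vecMulVec] at this

/-- Auxiliary lemma: `(k : Fin 4) : coeffSign (Cpos k) = 1`. [folklore] -/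
theorem coeffSign_Cpos (k : Fin 4) : coeffSign (Cpos k) = 1 := by
  simp [coeffSign, Cpos_ne_zero, Cpos_posDef]

/-- Auxiliary lemma: `: coeffSign J = -1`. [folklore] -/
theorem coeffSign_J : coeffSign J = -1 := by
  simp [coeffSign, J_ne_zero, not_posDef_of_neg_posDef neg_J_posDef]

/-- Auxiliary lemma: `{n : ℕ} {𝕜 : Type*} [RCLike 𝕜] : coeffSign (0 : Matrix (Fin n) (Fin n) 𝕜) = 0`. [folklore] -/
theorem coeffSign_zero' {n : ℕ} {𝕜 : Type*} [RCLike 𝕜] :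
    coeffSign (0 : Matrix (Fin n) (Fin n) 𝕜) = 0 := by
  simp [coeffSign]

/-- Auxiliary lemma: `: alpha Aw = 2`. [folklore] -/
theorem alpha_Aw : alpha Aw = 2 := by
  have : (List.ofFn fun i => coeffSign (Aw i)) = [1, 0, 0, 0, 0, 0, 1, -1, 1, 0, 0, 0, 0, 0, 0, 1] := by
    simp [List.ofFn_succ, Aw, coeffSign_Cpos, coeffSign_J, coeffSign_zero']
  unfold alpha
  rw [this]
  decide

/-- Auxiliary lemma: `: InS Aw`. [folklore] -/
theorem inS_Aw : InS Aw := by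
  intro i
  unfold Aw
  split_ifs
  · exact Or.inl (Cpos_posDef 0)
  · exact Or.inl (Cpos_posDef 1)
  · exact Or.inr (Or.inl neg_J_posDef)
  · exact Or.inl (Cpos_posDef 2)
  · exact Or.inl (Cpos_posDef 3)
  · exact Or.inr (Or.inr rfl)

/-- Auxiliary lemma: `: P.det ≠ 0`. [folklore] -/
theorem det_P_ne_zero : P.det ≠ 0 := by
  intro h
  have := alt 0
  rw [h] at this
  simp at this

/-- Auxiliary lemma: `: 6 ≤ zplus Aw`. [folklore] -/
theorem six_le_zplus_Aw : 6 ≤ zplus Aw := by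
  unfold zplus
  rw [matPoly_Aw]
  have hf : P.det.roots.filter (fun μ : ℝ => RCLike.im μ = 0 ∧ 0 < RCLike.re μ)
      = P.det.roots.filter (fun t => 0 < t) :=
    Multiset.filter_congr (fun x _ => by simp)
  rw [hf]
  calc 6 ≤ (P.det.roots.toFinset.filter (fun t => 0 < t)).card := six_le_card_posRoots_P
    _ = (P.det.roots.filter (fun t => 0 < t)).toFinset.card := by rw [Multiset.toFinset_filter]
    _ ≤ _ := Multiset.toFinset_card_le _

/-- The Cameron–Psarrakos rule (6) is false over `ℝ` (real symmetric coefficients): the `Witness` instance has `z₊ = 6 > 4 = 2·2`. [folklore] -/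
theorem cameronPsarrakosRule_real_false : ¬ CameronPsarrakosRule ℝ := by
  intro h
  have h1 := h 2 15 Aw inS_Aw (by rw [matPoly_Aw]; exact det_P_ne_zero)
  rw [alpha_Aw] at h1
  have h2 := six_le_zplus_Aw
  omega

/-! ### Transfer to complex Hermitian coefficients (the paper's setting) -/

/-- the witness with its integer entries read in `ℂ` [folklore] -/
noncomputable def AwC : Fin 16 → Matrix (Fin 2) (Fin 2) ℂ := fun i => (Aw i).map Complex.ofRealHom

/-- Auxiliary lemma: `{M : Matrix (Fin 2) (Fin 2) ℂ} (u : Fin 2 → ℂ) (h : M = Matrix.vecMulVec u (star u) + 1) : M.PosDef`. [folklore] -/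
theorem posDef_of_eq_vecMulVec_add_one {M : Matrix (Fin 2) (Fin 2) ℂ} (u : Fin 2 → ℂ)
    (h : M = Matrix.vecMulVec u (star u) + 1) : M.PosDef :=
  h ▸ Matrix.PosDef.posSemidef_add (Matrix.posSemidef_vecMulVec_self_star u) Matrix.PosDef.one

/-- Auxiliary lemma: `{M : Matrix (Fin 2) (Fin 2) ℂ} (u u' : Fin 2 → ℂ) (h : M = Matrix.vecMulVec u (star u) + Matrix.vecMulVec u' (star u') + 1) : M.PosDef`. [folklore] -/
theorem posDef_of_eq_vecMulVec_add_vecMulVec_add_one {M : Matrix (Fin 2) (Fin 2) ℂ} (u u' : Fin 2 → ℂ)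
    (h : M = Matrix.vecMulVec u (star u) + Matrix.vecMulVec u' (star u') + 1) : M.PosDef :=
  h ▸ Matrix.PosDef.posSemidef_add
    ((Matrix.posSemidef_vecMulVec_self_star u).add (Matrix.posSemidef_vecMulVec_self_star u'))
    Matrix.PosDef.one

/-- `10⁶·vvᵀ + I = (1000v)(1000v)ᴴ + I` over `ℂ`: the four positive definite coefficients stay positive definite [folklore] -/
theorem CposC_posDef (k : Fin 4) : ((Cpos k).map Complex.ofRealHom).PosDef := by
  fin_cases k
  · refine posDef_of_eq_vecMulVec_add_one (fun i => ((1000 * V 0 i : ℝ) : ℂ)) ?_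
    ext i j
    fin_cases i <;> fin_cases j <;> simp [Cpos, V, Matrix.vecMulVec, Complex.ext_iff]
    all_goals norm_num
  · refine posDef_of_eq_vecMulVec_add_one (fun i => ((1000 * V 1 i : ℝ) : ℂ)) ?_
    ext i j
    fin_cases i <;> fin_cases j <;> simp [Cpos, V, Matrix.vecMulVec, Complex.ext_iff]
    all_goals norm_num
  · refine posDef_of_eq_vecMulVec_add_vecMulVec_add_one (fun i => ((1000 * V 2 i : ℝ) : ℂ))
      (fun i => ((1000 * V 3 i : ℝ) : ℂ)) ?_
    ext i j
    fin_cases i <;> fin_cases j <;> simp [Cpos, V, Matrix.vecMulVec, Complex.ext_iff]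
    all_goals norm_num
  · refine posDef_of_eq_vecMulVec_add_one (fun i => ((1000 * V 4 i : ℝ) : ℂ)) ?_
    ext i j
    fin_cases i <;> fin_cases j <;> simp [Cpos, V, Matrix.vecMulVec, Complex.ext_iff]
    all_goals norm_num

/-- `C₇` stays negative definite over `ℂ` [folklore] -/
theorem neg_JC_posDef : (-(J.map Complex.ofRealHom)).PosDef := by
  refine posDef_of_eq_vecMulVec_add_one (fun i => ((1000 * w i : ℝ) : ℂ)) ?_
  ext i j
  fin_cases i <;> fin_cases j <;> simp [J, w, Matrix.vecMulVec, Complex.ext_iff]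
  all_goals norm_num

/-- Auxiliary lemma: `(k : Fin 4) : (Cpos k).map Complex.ofRealHom ≠ 0`. [folklore] -/
theorem CposC_ne_zero (k : Fin 4) : (Cpos k).map Complex.ofRealHom ≠ 0 := by
  intro h
  have := congrFun (congrFun h 0) 0
  fin_cases k <;> simp [Cpos, V, Matrix.vecMulVec] at this <;> norm_num at this

/-- Auxiliary lemma: `: J.map Complex.ofRealHom ≠ 0`. [folklore] -/
theorem JC_ne_zero : J.map Complex.ofRealHom ≠ 0 := by
  intro h
  have := congrFun (congrFun h 0) 0
  simp [J, w, Matrix.vecMulVec] at this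

/-- Auxiliary lemma: `: alpha AwC = 2`. [folklore] -/
theorem alpha_AwC : alpha AwC = 2 := by
  have hC : ∀ k : Fin 4, coeffSign ((Cpos k).map Complex.ofRealHom) = 1 := fun k => by
    simp [coeffSign, CposC_ne_zero, CposC_posDef]
  have hJ : coeffSign (J.map Complex.ofRealHom) = -1 := by
    simp [coeffSign, JC_ne_zero, not_posDef_of_neg_posDef neg_JC_posDef]
  have : (List.ofFn fun i => coeffSign (AwC i)) = [1, 0, 0, 0, 0, 0, 1, -1, 1, 0, 0, 0, 0, 0, 0, 1] := by
    simp [List.ofFn_succ, AwC, Aw, hC, hJ, coeffSign_zero']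
  unfold alpha
  rw [this]
  decide

/-- Auxiliary lemma: `: InS AwC`. [folklore] -/
theorem inS_AwC : InS AwC := by
  intro i
  unfold AwC Aw
  split_ifs
  · exact Or.inl (CposC_posDef 0)
  · exact Or.inl (CposC_posDef 1)
  · exact Or.inr (Or.inl neg_JC_posDef)
  · exact Or.inl (CposC_posDef 2)
  · exact Or.inl (CposC_posDef 3)
  · exact Or.inr (Or.inr (by simp))

/-- the complex matrix polynomial is the real one with coefficients read in `ℂ` [folklore] -/
theorem matPoly_AwC :
    matPoly AwC = (Polynomial.mapRingHom Complex.ofRealHom).mapMatrix (matPoly Aw) := by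
  ext j k
  simp [matPoly, AwC, Matrix.sum_apply]

/-- Auxiliary lemma: `: (matPoly AwC).det = (P.det).map Complex.ofRealHom`. [folklore] -/
theorem det_matPoly_AwC : (matPoly AwC).det = (P.det).map Complex.ofRealHom := by
  rw [matPoly_AwC, ← RingHom.map_det, matPoly_Aw]
  rfl

/-- Auxiliary lemma: `: (matPoly AwC).det ≠ 0`. [folklore] -/
theorem det_matPoly_AwC_ne_zero : (matPoly AwC).det ≠ 0 := by
  rw [det_matPoly_AwC]
  exact (Polynomial.map_ne_zero_iff Complex.ofReal_injective).mpr det_P_ne_zero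

/-- Auxiliary lemma: `: 6 ≤ zplus AwC`. [folklore] -/
theorem six_le_zplus_AwC : 6 ≤ zplus AwC := by
  unfold zplus
  rw [det_matPoly_AwC]
  have hne : (P.det).map Complex.ofRealHom ≠ 0 :=
    (Polynomial.map_ne_zero_iff (f := Complex.ofRealHom) Complex.ofReal_injective).mpr det_P_ne_zero
  have hle := Polynomial.map_roots_le hne
  have h1 : Multiset.card (((P.det.roots.map Complex.ofRealHom)).filter
      (fun μ : ℂ => RCLike.im μ = 0 ∧ 0 < RCLike.re μ)) = Multiset.card (P.det.roots.filter (fun t => 0 < t)) := by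
    rw [Multiset.filter_map, Multiset.card_map]
    congr 1
    exact Multiset.filter_congr (fun x _ => by simp)
  calc 6 ≤ (P.det.roots.toFinset.filter (fun t => 0 < t)).card := six_le_card_posRoots_P
    _ = (P.det.roots.filter (fun t => 0 < t)).toFinset.card := by rw [Multiset.toFinset_filter]
    _ ≤ Multiset.card (P.det.roots.filter (fun t => 0 < t)) := Multiset.toFinset_card_le _
    _ = _ := h1.symm
    _ ≤ _ := Multiset.card_le_card (Multiset.filter_le_filter _ hle)

/-- The Cameron–Psarrakos rule (6) is false over `ℂ` (complex Hermitian coefficients, the paper's setting): the integer witness read in `ℂ`. [folklore] -/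
theorem cameronPsarrakosRule_complex_false : ¬ CameronPsarrakosRule ℂ := by
  intro h
  have h1 := h 2 15 AwC inS_AwC det_matPoly_AwC_ne_zero
  rw [alpha_AwC] at h1
  have h2 := six_le_zplus_AwC
  omega

end Literature.LinearAlgebra.MatrixPolynomials.CameronPsarrakos2019
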